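import Summits.CriticalPhenomena.PercolationContinuityZ3.Theorems.PercNearOneGluingNoHeavyQuantSDEC
import HarnessLib

/-!
# QUANT lane: STOCHASTIC LOWERING ("push-down") of a factor — it preserves the two-layer rows at a target, moves the mean onto
# the target's integer ceiling cell, and is monotone for the low / high masses of `lconv`

builds on p205010 (kernel theorem, internal audit signed; external expert review pending)

Support file (`--supports stmt-CriticalPhenomena-4575`), QUANT lane seat prim-quant-arm-1 (gen 42); memo
`run/shared/lean/prim/quant/prim-quant-arm-1-g42/PHANTOM-ROWS-G42.md` §5 (LEAN, route (b)).  Imports only `…QuantSDEC`; one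
auxiliary definition (`pushDown`), no sorries, standard axioms.

PURPOSE.  The heavy node `TLBGateConvClosedHeavy` is, by ✓ `…QuantTLBBelowTargets` (rows `k < q·min Tᵢ`) and ✓ `…QuantPhantomRowsSharp`
(rows `k ≥ q·T_small`), reduced to ONE input: Theorem A (prim-quant-arm-2 g38, `twoLayer_lconv_of_half_le`) with the targets as FREE
parameters `τᵢ ≤ mean` — the tree's Theorem A ties the target to the mean.  The gap is closed by lowering each factor: move the part of
`ν` above `c := ⌈τ⌉₊` down onto `c`, partially (`pushDown ν M c θ`, `0 ≤ θ ≤ 1`).  Then (`pushDown_rows`) every two-layer row of `ν`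
at target `τ ≤ c` is a row of the lowered law VERBATIM (cells `< c` untouched, the set `{h ≥ τ − j}` contains `c` and everything
above it); (`pushDown_mean`) the mean drops by `θ·D`, `D = Σ_{j > c}(j − c)ν j`, continuously from the mean of `ν` to at most `c`, so
it can be parked anywhere in `[τ, ⌈τ⌉]`, where targets have the same integer rows; and lowering a factor can only RAISE the low
masses `Σ_{h ≤ k} lconv` and LOWER the high masses `Σ_{θ ≤ h} lconv` of a convolution (`lconv_low_mono_of_cdf`,
`lconv_high_anti_of_cdf`, from the distribution-function domination `pushDown_cdf`), so a row proved for the lowered pair transfers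
back to the original pair.  Composition with Theorem A by name waits for ⧗ p375979's olean.

* `LawDec.lconv_low_mono_of_cdf`, `LawDec.lconv_high_anti_of_cdf` — monotonicity of `lconv`'s low / high masses in the first
  factor under distribution-function domination with equal mass.
* `LawDec.pushDown` and `pushDown_nonneg / _eq_zero / _sum / _mean / _cdf / _cdf_le / _mean_park / _rows`.

[this work].  The rows served belong to the gluing programme of [cite: KozmaNitzan2024, Conjecture 3 (p. 15)].
-/

noncomputable section

namespace Summit.CriticalPhenomena.PercolationContinuityZ3.Theorems

namespace Quant

open Finset

namespace LawDec

/-- a test function against the convolution (as in `…QuantTLBBelowTargets`). [this work] -/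
private theorem pd_sum_fun_mul_lconv (M₁ M₂ : ℕ) (μ₁ μ₂ : ℕ → ℝ) (ψ : ℕ → ℝ) :
    ∑ h ∈ Finset.range (M₁ + M₂ + 1), ψ h * lconv M₁ M₂ μ₁ μ₂ h
      = ∑ a ∈ Finset.range (M₁ + 1), ∑ s ∈ Finset.range (M₂ + 1), ψ (a + s) * (μ₁ a * μ₂ s) := by
  simp only [lconv, Finset.mul_sum]
  rw [Finset.sum_comm]
  refine Finset.sum_congr rfl fun a ha => ?_
  rw [Finset.sum_comm]
  refine Finset.sum_congr rfl fun s hs => ?_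
  rw [Finset.mem_range] at ha hs
  have e : ∀ h : ℕ, ψ h * (if a + s = h then μ₁ a * μ₂ s else 0) = if a + s = h then ψ (a + s) * (μ₁ a * μ₂ s) else 0 :=
    fun h => by split_ifs with hh <;> simp [hh]
  simp_rw [e]
  rw [Finset.sum_ite_eq (Finset.range (M₁ + M₂ + 1)) (a + s), if_pos (Finset.mem_range.2 (by omega))]

/-- an indicator sum over the convolution, as a double sum. [this work] -/
private theorem pd_sum_ite_lconv (M₁ M₂ : ℕ) (μ₁ μ₂ : ℕ → ℝ) (P : ℕ → Prop) [DecidablePred P] :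
    ∑ h ∈ Finset.range (M₁ + M₂ + 1), (if P h then lconv M₁ M₂ μ₁ μ₂ h else 0)
      = ∑ s ∈ Finset.range (M₂ + 1), μ₂ s * ∑ a ∈ Finset.range (M₁ + 1), (if P (a + s) then μ₁ a else 0) := by
  have e1 : ∑ h ∈ Finset.range (M₁ + M₂ + 1), (if P h then lconv M₁ M₂ μ₁ μ₂ h else 0)
      = ∑ h ∈ Finset.range (M₁ + M₂ + 1), (if P h then (1 : ℝ) else 0) * lconv M₁ M₂ μ₁ μ₂ h :=
    Finset.sum_congr rfl fun h _ => by split_ifs <;> simp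
  rw [e1, pd_sum_fun_mul_lconv, Finset.sum_comm]
  refine Finset.sum_congr rfl fun s _ => ?_
  rw [Finset.mul_sum]
  refine Finset.sum_congr rfl fun a _ => ?_
  split_ifs <;> ring

/-! ### Monotonicity of `lconv` under distribution-function domination -/

/-- **low masses of `lconv` grow when the first factor is stochastically lowered**: if `ν₂ ≥ 0` and `Σ_{a ≤ x} ν₁ a ≤ Σ_{a ≤ x} ν₁′ a`
for every `x` (sums over `{0..M₁}`), then `Σ_{h ≤ k} lconv ν₁ ν₂ h ≤ Σ_{h ≤ k} lconv ν₁′ ν₂ h`. [this work] -/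
theorem lconv_low_mono_of_cdf {M₁ M₂ : ℕ} {ν₁ ν₁' ν₂ : ℕ → ℝ} (h20 : ∀ s, 0 ≤ ν₂ s)
    (hcdf : ∀ x : ℕ, ∑ a ∈ Finset.range (M₁ + 1), (if a ≤ x then ν₁ a else 0)
      ≤ ∑ a ∈ Finset.range (M₁ + 1), (if a ≤ x then ν₁' a else 0)) (k : ℕ) :
    ∑ h ∈ Finset.range (M₁ + M₂ + 1), (if h ≤ k then lconv M₁ M₂ ν₁ ν₂ h else 0)
      ≤ ∑ h ∈ Finset.range (M₁ + M₂ + 1), (if h ≤ k then lconv M₁ M₂ ν₁' ν₂ h else 0) := by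
  rw [pd_sum_ite_lconv, pd_sum_ite_lconv]
  refine Finset.sum_le_sum fun s _ => mul_le_mul_of_nonneg_left ?_ (h20 s)
  by_cases hs : s ≤ k
  · have e : ∀ ν : ℕ → ℝ, ∑ a ∈ Finset.range (M₁ + 1), (if a + s ≤ k then ν a else 0)
        = ∑ a ∈ Finset.range (M₁ + 1), (if a ≤ k - s then ν a else 0) := by
      intro ν
      refine Finset.sum_congr rfl fun a _ => ?_
      have : (a + s ≤ k) ↔ (a ≤ k - s) := by omega
      simp only [this]
    rw [e ν₁, e ν₁']
    exact hcdf (k - s)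
  · have e : ∀ ν : ℕ → ℝ, ∑ a ∈ Finset.range (M₁ + 1), (if a + s ≤ k then ν a else 0) = 0 := by
      intro ν
      refine Finset.sum_eq_zero fun a _ => ?_
      rw [if_neg (by omega)]
    rw [e ν₁, e ν₁']

/-- **high masses of `lconv` shrink when the first factor is stochastically lowered**: if `ν₂ ≥ 0`, the two first factors have the
same mass on `{0..M₁}` and `Σ_{a < x} ν₁ a ≤ Σ_{a < x} ν₁′ a` for every real `x`, then for every real threshold `θ`:
`Σ_{θ ≤ h} lconv ν₁′ ν₂ h ≤ Σ_{θ ≤ h} lconv ν₁ ν₂ h`. [this work] -/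
theorem lconv_high_anti_of_cdf {M₁ M₂ : ℕ} {ν₁ ν₁' ν₂ : ℕ → ℝ} (h20 : ∀ s, 0 ≤ ν₂ s)
    (hmass : ∑ a ∈ Finset.range (M₁ + 1), ν₁' a = ∑ a ∈ Finset.range (M₁ + 1), ν₁ a)
    (hcdf : ∀ x : ℝ, ∑ a ∈ Finset.range (M₁ + 1), (if (a : ℝ) < x then ν₁ a else 0)
      ≤ ∑ a ∈ Finset.range (M₁ + 1), (if (a : ℝ) < x then ν₁' a else 0)) (θ : ℝ) :
    ∑ h ∈ Finset.range (M₁ + M₂ + 1), (if θ ≤ (h : ℝ) then lconv M₁ M₂ ν₁' ν₂ h else 0)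
      ≤ ∑ h ∈ Finset.range (M₁ + M₂ + 1), (if θ ≤ (h : ℝ) then lconv M₁ M₂ ν₁ ν₂ h else 0) := by
  rw [pd_sum_ite_lconv, pd_sum_ite_lconv]
  refine Finset.sum_le_sum fun s _ => mul_le_mul_of_nonneg_left ?_ (h20 s)
  -- tail above `θ − s` = mass − (part below `θ − s`)
  have e : ∀ ν : ℕ → ℝ, ∑ a ∈ Finset.range (M₁ + 1), (if θ ≤ ((a + s : ℕ) : ℝ) then ν a else 0)
      = ∑ a ∈ Finset.range (M₁ + 1), ν a - ∑ a ∈ Finset.range (M₁ + 1), (if (a : ℝ) < θ - s then ν a else 0) := by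
    intro ν
    rw [eq_sub_iff_add_eq, ← Finset.sum_add_distrib]
    refine Finset.sum_congr rfl fun a _ => ?_
    by_cases h : θ ≤ ((a + s : ℕ) : ℝ)
    · have h' : ¬ ((a : ℝ) < θ - s) := by push_cast at h; linarith
      rw [if_pos h, if_neg h', add_zero]
    · have h' : (a : ℝ) < θ - s := by push_cast at h; linarith
      rw [if_neg h, if_pos h', zero_add]
  rw [e ν₁, e ν₁', hmass]
  linarith [hcdf (θ - s)]

/-! ### The push-down of a law onto a cell `c` -/

/-- **`pushDown ν M c θ`**: keep `ν` below `c`, put `ν c + θ·Σ_{c < j ≤ M} ν j` at `c`, keep the fraction `1 − θ` of `ν` above `c`.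
[this work] -/
def pushDown (ν : ℕ → ℝ) (M c : ℕ) (θ : ℝ) : ℕ → ℝ := fun h =>
  if h < c then ν h
  else if h = c then ν c + θ * ∑ j ∈ Finset.range (M + 1), (if c < j then ν j else 0)
  else (1 - θ) * ν h

/-- `pushDown` is nonnegative (`ν ≥ 0`, `0 ≤ θ ≤ 1`). [this work] -/
theorem pushDown_nonneg {ν : ℕ → ℝ} {M c : ℕ} {θ : ℝ} (hν : ∀ h, 0 ≤ ν h) (hθ0 : 0 ≤ θ) (hθ1 : θ ≤ 1) (h : ℕ) :
    0 ≤ pushDown ν M c θ h := by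
  simp only [pushDown]
  split_ifs
  · exact hν h
  · exact add_nonneg (hν c) (mul_nonneg hθ0 (Finset.sum_nonneg fun j _ => by split_ifs; exacts [hν j, le_rfl]))
  · exact mul_nonneg (by linarith) (hν h)

/-- `pushDown` vanishes where `ν` does, above `c`. [this work] -/
theorem pushDown_eq_zero {ν : ℕ → ℝ} {M c : ℕ} {θ : ℝ} (h : ℕ) (hc : c < h) (hν : ν h = 0) :
    pushDown ν M c θ h = 0 := by
  simp only [pushDown, if_neg (show ¬ h < c by omega), if_neg (show h ≠ c by omega), hν, mul_zero]

/-- `pushDown` agrees with `ν` below `c`. [this work] -/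
theorem pushDown_of_lt {ν : ℕ → ℝ} {M c : ℕ} {θ : ℝ} (h : ℕ) (hc : h < c) : pushDown ν M c θ h = ν h := by
  simp only [pushDown, if_pos hc]

/-- **mass**: `pushDown` has the mass of `ν` on `{0..M}` (`c ≤ M`). [this work] -/
theorem pushDown_sum {ν : ℕ → ℝ} {M c : ℕ} (θ : ℝ) (hcM : c ≤ M) :
    ∑ h ∈ Finset.range (M + 1), pushDown ν M c θ h = ∑ h ∈ Finset.range (M + 1), ν h := by
  -- write both sides as (below c) + (at c) + (above c)
  have split : ∀ f : ℕ → ℝ, ∑ h ∈ Finset.range (M + 1), f h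
      = ∑ h ∈ Finset.range (M + 1), (if h < c then f h else 0) + f c
        + ∑ h ∈ Finset.range (M + 1), (if c < h then f h else 0) := by
    intro f
    have e : ∀ h ∈ Finset.range (M + 1), f h
        = (if h < c then f h else 0) + (if h = c then f h else 0) + (if c < h then f h else 0) := by
      intro h _
      rcases Nat.lt_trichotomy h c with hlt | heq | hgt
      · rw [if_pos hlt, if_neg (by omega), if_neg (by omega)]; ring
      · rw [if_neg (by omega), if_pos heq, if_neg (by omega)]; ring
      · rw [if_neg (by omega), if_neg (by omega), if_pos hgt]; ring
    rw [Finset.sum_congr rfl e, Finset.sum_add_distrib, Finset.sum_add_distrib,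
      Finset.sum_ite_eq' (Finset.range (M + 1)) c, if_pos (Finset.mem_range.2 (by omega))]
  rw [split (pushDown ν M c θ), split ν]
  have e1 : ∑ h ∈ Finset.range (M + 1), (if h < c then pushDown ν M c θ h else 0)
      = ∑ h ∈ Finset.range (M + 1), (if h < c then ν h else 0) :=
    Finset.sum_congr rfl fun h _ => by split_ifs with hh; exacts [pushDown_of_lt h hh, rfl]
  have e2 : pushDown ν M c θ c = ν c + θ * ∑ j ∈ Finset.range (M + 1), (if c < j then ν j else 0) := by
    simp only [pushDown, lt_irrefl, if_false, if_true]
  have e3 : ∑ h ∈ Finset.range (M + 1), (if c < h then pushDown ν M c θ h else 0)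
      = (1 - θ) * ∑ h ∈ Finset.range (M + 1), (if c < h then ν h else 0) := by
    rw [Finset.mul_sum]
    refine Finset.sum_congr rfl fun h _ => ?_
    split_ifs with hh
    · simp only [pushDown, if_neg (show ¬ h < c by omega), if_neg (show h ≠ c by omega)]
    · rw [mul_zero]
  rw [e1, e2, e3]
  ring

/-- **mean**: the mean of `pushDown` is the mean of `ν` minus `θ·D`, `D = Σ_{c < j ≤ M} (j − c)·ν j ≥ 0`. [this work] -/
theorem pushDown_mean {ν : ℕ → ℝ} {M c : ℕ} (θ : ℝ) (hcM : c ≤ M) :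
    ∑ h ∈ Finset.range (M + 1), (h : ℝ) * pushDown ν M c θ h
      = ∑ h ∈ Finset.range (M + 1), (h : ℝ) * ν h
        - θ * ∑ j ∈ Finset.range (M + 1), (if c < j then ((j : ℝ) - c) * ν j else 0) := by
  have split : ∀ f : ℕ → ℝ, ∑ h ∈ Finset.range (M + 1), (h : ℝ) * f h
      = ∑ h ∈ Finset.range (M + 1), (if h < c then (h : ℝ) * f h else 0) + (c : ℝ) * f c
        + ∑ h ∈ Finset.range (M + 1), (if c < h then (h : ℝ) * f h else 0) := by
    intro f
    have e : ∀ h ∈ Finset.range (M + 1), (h : ℝ) * f h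
        = (if h < c then (h : ℝ) * f h else 0) + (if h = c then (h : ℝ) * f h else 0)
          + (if c < h then (h : ℝ) * f h else 0) := by
      intro h _
      rcases Nat.lt_trichotomy h c with hlt | heq | hgt
      · rw [if_pos hlt, if_neg (by omega), if_neg (by omega)]; ring
      · rw [if_neg (by omega), if_pos heq, if_neg (by omega)]; ring
      · rw [if_neg (by omega), if_neg (by omega), if_pos hgt]; ring
    rw [Finset.sum_congr rfl e, Finset.sum_add_distrib, Finset.sum_add_distrib,
      Finset.sum_ite_eq' (Finset.range (M + 1)) c, if_pos (Finset.mem_range.2 (by omega))]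
  rw [split (pushDown ν M c θ), split ν]
  have e1 : ∑ h ∈ Finset.range (M + 1), (if h < c then (h : ℝ) * pushDown ν M c θ h else 0)
      = ∑ h ∈ Finset.range (M + 1), (if h < c then (h : ℝ) * ν h else 0) := by
    refine Finset.sum_congr rfl fun h _ => ?_
    by_cases hh : h < c
    · rw [if_pos hh, if_pos hh, pushDown_of_lt h hh]
    · rw [if_neg hh, if_neg hh]
  have e2 : pushDown ν M c θ c = ν c + θ * ∑ j ∈ Finset.range (M + 1), (if c < j then ν j else 0) := by
    simp only [pushDown, lt_irrefl, if_false, if_true]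
  have e3 : ∑ h ∈ Finset.range (M + 1), (if c < h then (h : ℝ) * pushDown ν M c θ h else 0)
      = (1 - θ) * ∑ h ∈ Finset.range (M + 1), (if c < h then (h : ℝ) * ν h else 0) := by
    rw [Finset.mul_sum]
    refine Finset.sum_congr rfl fun h _ => ?_
    split_ifs with hh
    · simp only [pushDown, if_neg (show ¬ h < c by omega), if_neg (show h ≠ c by omega)]; ring
    · rw [mul_zero]
  have e4 : ∑ j ∈ Finset.range (M + 1), (if c < j then ((j : ℝ) - c) * ν j else 0)
      = ∑ j ∈ Finset.range (M + 1), (if c < j then (j : ℝ) * ν j else 0)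
        - (c : ℝ) * ∑ j ∈ Finset.range (M + 1), (if c < j then ν j else 0) := by
    rw [Finset.mul_sum, ← Finset.sum_sub_distrib]
    refine Finset.sum_congr rfl fun j _ => ?_
    split_ifs <;> ring
  rw [e1, e2, e3, e4]
  ring

/-- **distribution-function domination** (real thresholds): for `ν ≥ 0`, `0 ≤ θ`, `c ≤ M`, and every real `x`,
`Σ_{a < x} ν a ≤ Σ_{a < x} pushDown ν M c θ a` (sums over `{0..M}`). [this work] -/
theorem pushDown_cdf {ν : ℕ → ℝ} {M c : ℕ} {θ : ℝ} (hν : ∀ h, 0 ≤ ν h) (hθ0 : 0 ≤ θ) (hcM : c ≤ M) (x : ℝ) :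
    ∑ a ∈ Finset.range (M + 1), (if (a : ℝ) < x then ν a else 0)
      ≤ ∑ a ∈ Finset.range (M + 1), (if (a : ℝ) < x then pushDown ν M c θ a else 0) := by
  by_cases hxc : x ≤ (c : ℝ)
  · -- below `c` nothing changes
    refine le_of_eq (Finset.sum_congr rfl fun a _ => ?_)
    by_cases hax : (a : ℝ) < x
    · have hac : a < c := by exact_mod_cast lt_of_lt_of_le hax hxc
      rw [if_pos hax, if_pos hax, pushDown_of_lt a hac]
    · rw [if_neg hax, if_neg hax]
  · -- `x > c`: the cell `c` has gained `θ·(mass above c)`, the cells above lost the fraction `θ` of a PART of that mass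
    have hcx : (c : ℝ) < x := not_le.mp hxc
    have key : ∀ a ∈ Finset.range (M + 1),
        (if (a : ℝ) < x then pushDown ν M c θ a else 0) - (if (a : ℝ) < x then ν a else 0)
          ≥ θ * ((if a = c then ∑ j ∈ Finset.range (M + 1), (if c < j then ν j else 0) else 0)
                 - (if c < a then ν a else 0)) := by
      intro a _
      rcases Nat.lt_trichotomy a c with hlt | heq | hgt
      · have hax : (a : ℝ) < x := lt_trans (by exact_mod_cast hlt) hcx
        rw [if_pos hax, if_pos hax, pushDown_of_lt a hlt, if_neg (by omega), if_neg (by omega)]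
        simp
      · subst heq
        rw [if_pos hcx, if_pos hcx, if_pos rfl, if_neg (lt_irrefl a)]
        simp only [pushDown, lt_irrefl, if_false, if_true]
        linarith
      · rw [if_neg (show a ≠ c by omega), if_pos hgt]
        by_cases hax : (a : ℝ) < x
        · rw [if_pos hax, if_pos hax]
          simp only [pushDown, if_neg (show ¬ a < c by omega), if_neg (show a ≠ c by omega)]
          nlinarith [hν a]
        · rw [if_neg hax, if_neg hax]
          nlinarith [hν a]
    have hsum := Finset.sum_le_sum fun a ha => key a ha
    rw [Finset.sum_sub_distrib, ← Finset.mul_sum, Finset.sum_sub_distrib,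
      Finset.sum_ite_eq' (Finset.range (M + 1)) c, if_pos (Finset.mem_range.2 (by omega)), sub_self, mul_zero] at hsum
    linarith

/-- distribution-function domination, integer thresholds: `Σ_{a ≤ x} ν a ≤ Σ_{a ≤ x} pushDown ν M c θ a`. [this work] -/
theorem pushDown_cdf_le {ν : ℕ → ℝ} {M c : ℕ} {θ : ℝ} (hν : ∀ h, 0 ≤ ν h) (hθ0 : 0 ≤ θ) (hcM : c ≤ M) (x : ℕ) :
    ∑ a ∈ Finset.range (M + 1), (if a ≤ x then ν a else 0)
      ≤ ∑ a ∈ Finset.range (M + 1), (if a ≤ x then pushDown ν M c θ a else 0) := by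
  have e : ∀ f : ℕ → ℝ, ∑ a ∈ Finset.range (M + 1), (if a ≤ x then f a else 0)
      = ∑ a ∈ Finset.range (M + 1), (if (a : ℝ) < (x : ℝ) + 1 then f a else 0) := by
    intro f
    refine Finset.sum_congr rfl fun a _ => ?_
    have : (a ≤ x) ↔ ((a : ℝ) < (x : ℝ) + 1) := by
      constructor
      · intro h; exact_mod_cast Nat.lt_succ_of_le h
      · intro h; exact_mod_cast Nat.lt_succ_iff.mp (by exact_mod_cast h)
    simp only [this]
  rw [e ν, e (pushDown ν M c θ)]
  exact pushDown_cdf hν hθ0 hcM _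

/-- **parking the mean**: for a probability law `ν ≥ 0` on `{0..M}` and a cell `c ≤ M` there is `θ ∈ [0,1]` such that the mean of
`pushDown ν M c θ` is `min(mean ν, c)` (`θ = 0` if the mean is already `≤ c`; else `θ = (mean − c)/D`, using that the fully
pushed-down law has mean `≤ c`). [this work] -/
theorem pushDown_mean_park {ν : ℕ → ℝ} {M c : ℕ} (hν : ∀ h, 0 ≤ ν h) (hν1 : ∑ h ∈ Finset.range (M + 1), ν h = 1)
    (hcM : c ≤ M) :
    ∃ θ : ℝ, 0 ≤ θ ∧ θ ≤ 1 ∧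
      ∑ h ∈ Finset.range (M + 1), (h : ℝ) * pushDown ν M c θ h = min (∑ h ∈ Finset.range (M + 1), (h : ℝ) * ν h) (c : ℝ) := by
  set T : ℝ := ∑ h ∈ Finset.range (M + 1), (h : ℝ) * ν h with hT
  set D : ℝ := ∑ j ∈ Finset.range (M + 1), (if c < j then ((j : ℝ) - c) * ν j else 0) with hD
  by_cases hTc : T ≤ (c : ℝ)
  · refine ⟨0, le_rfl, zero_le_one, ?_⟩
    rw [pushDown_mean 0 hcM, ← hT, ← hD, zero_mul, sub_zero, min_eq_left hTc]
  · have hcT : (c : ℝ) < T := not_le.mp hTc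
    -- the fully pushed-down mean `T − D` is at most `c`
    have hTD : T - D ≤ (c : ℝ) := by
      have e : T - D = ∑ h ∈ Finset.range (M + 1), (if c < h then (c : ℝ) * ν h else (h : ℝ) * ν h) := by
        rw [hT, hD, ← Finset.sum_sub_distrib]
        refine Finset.sum_congr rfl fun h _ => ?_
        split_ifs <;> ring
      have hle : ∑ h ∈ Finset.range (M + 1), (if c < h then (c : ℝ) * ν h else (h : ℝ) * ν h)
          ≤ ∑ h ∈ Finset.range (M + 1), (c : ℝ) * ν h := by
        refine Finset.sum_le_sum fun h _ => ?_
        split_ifs with hh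
        · exact le_rfl
        · have : (h : ℝ) ≤ c := by exact_mod_cast not_lt.mp hh
          exact mul_le_mul_of_nonneg_right this (hν h)
      rw [e]
      calc _ ≤ ∑ h ∈ Finset.range (M + 1), (c : ℝ) * ν h := hle
        _ = (c : ℝ) := by rw [← Finset.mul_sum, hν1, mul_one]
    have hD0 : 0 < D := by linarith
    refine ⟨(T - c) / D, div_nonneg (by linarith) hD0.le, (div_le_one hD0).mpr (by linarith), ?_⟩
    rw [pushDown_mean _ hcM, ← hT, ← hD, min_eq_right hcT.le]
    field_simp
    ring

/-- **rows are preserved**: if `τ ≤ c` then every two-layer row of `ν` at target `τ` — `u·Σ_{h ≤ j} ν h ≤ Σ_{τ − j ≤ h} ν h` with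
`2j < τ` — holds verbatim for `pushDown ν M c θ` (`c ≤ M`; cells `≤ j < c` untouched; the set `{τ − j ≤ h}` contains `c` and every
cell above it, whose total mass is unchanged). [this work] -/
theorem pushDown_rows {ν : ℕ → ℝ} {M c : ℕ} {θ τ u : ℝ} (hcM : c ≤ M) (hτc : τ ≤ (c : ℝ))
    (hrows : ∀ j : ℕ, 2 * (j : ℝ) < τ →
      u * ∑ h ∈ Finset.range (j + 1), ν h ≤ ∑ h ∈ Finset.range (M + 1), (if τ - j ≤ (h : ℝ) then ν h else 0))
    (j : ℕ) (hj : 2 * (j : ℝ) < τ) :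
    u * ∑ h ∈ Finset.range (j + 1), pushDown ν M c θ h
      ≤ ∑ h ∈ Finset.range (M + 1), (if τ - j ≤ (h : ℝ) then pushDown ν M c θ h else 0) := by
  have hjr : (0 : ℝ) ≤ j := Nat.cast_nonneg j
  have hjc : j < c := by
    have : (j : ℝ) < c := by linarith
    exact_mod_cast this
  -- left side unchanged
  have e1 : ∑ h ∈ Finset.range (j + 1), pushDown ν M c θ h = ∑ h ∈ Finset.range (j + 1), ν h :=
    Finset.sum_congr rfl fun h hh => by
      rw [Finset.mem_range] at hh
      exact pushDown_of_lt h (by omega)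
  -- right side unchanged: split at `c`
  have hτjc : τ - j ≤ (c : ℝ) := by linarith
  have e2 : ∀ f : ℕ → ℝ, ∑ h ∈ Finset.range (M + 1), (if τ - j ≤ (h : ℝ) then f h else 0)
      = ∑ h ∈ Finset.range (M + 1), (if τ - j ≤ (h : ℝ) ∧ h < c then f h else 0) + f c
        + ∑ h ∈ Finset.range (M + 1), (if c < h then f h else 0) := by
    intro f
    have e : ∀ h ∈ Finset.range (M + 1), (if τ - j ≤ (h : ℝ) then f h else 0)
        = (if τ - j ≤ (h : ℝ) ∧ h < c then f h else 0) + (if h = c then f h else 0) + (if c < h then f h else 0) := by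
      intro h _
      rcases Nat.lt_trichotomy h c with hlt | heq | hgt
      · rw [if_neg (show h ≠ c by omega), if_neg (show ¬ c < h by omega), add_zero, add_zero]
        by_cases ht : τ - j ≤ (h : ℝ)
        · rw [if_pos ht, if_pos ⟨ht, hlt⟩]
        · rw [if_neg ht, if_neg (fun hh => ht hh.1)]
      · subst heq
        rw [if_pos hτjc, if_neg (fun hh => lt_irrefl _ hh.2), if_pos rfl, if_neg (lt_irrefl _)]; ring
      · have ht : τ - j ≤ (h : ℝ) := le_trans hτjc (by exact_mod_cast hgt.le)
        rw [if_pos ht, if_neg (show ¬ (τ - j ≤ (h : ℝ) ∧ h < c) from fun hh => by omega), if_neg (show h ≠ c by omega),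
          if_pos hgt]; ring
    rw [Finset.sum_congr rfl e, Finset.sum_add_distrib, Finset.sum_add_distrib,
      Finset.sum_ite_eq' (Finset.range (M + 1)) c, if_pos (Finset.mem_range.2 (by omega))]
  have e3 : ∑ h ∈ Finset.range (M + 1), (if τ - j ≤ (h : ℝ) ∧ h < c then pushDown ν M c θ h else 0)
      = ∑ h ∈ Finset.range (M + 1), (if τ - j ≤ (h : ℝ) ∧ h < c then ν h else 0) :=
    Finset.sum_congr rfl fun h _ => by split_ifs with hh; exacts [pushDown_of_lt h hh.2, rfl]
  have e4 : pushDown ν M c θ c + ∑ h ∈ Finset.range (M + 1), (if c < h then pushDown ν M c θ h else 0)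
      = ν c + ∑ h ∈ Finset.range (M + 1), (if c < h then ν h else 0) := by
    have ec : pushDown ν M c θ c = ν c + θ * ∑ j ∈ Finset.range (M + 1), (if c < j then ν j else 0) := by
      simp only [pushDown, lt_irrefl, if_false, if_true]
    have ea : ∑ h ∈ Finset.range (M + 1), (if c < h then pushDown ν M c θ h else 0)
        = (1 - θ) * ∑ h ∈ Finset.range (M + 1), (if c < h then ν h else 0) := by
      rw [Finset.mul_sum]
      refine Finset.sum_congr rfl fun h _ => ?_
      split_ifs with hh
      · simp only [pushDown, if_neg (show ¬ h < c by omega), if_neg (show h ≠ c by omega)]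
      · rw [mul_zero]
    rw [ec, ea]; ring
  rw [e1, e2 (pushDown ν M c θ), e3, add_assoc, e4, ← add_assoc, ← e2 ν]
  exact hrows j hj

end LawDec

end Quant

end Summit.CriticalPhenomena.PercolationContinuityZ3.Theorems
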